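import Literature.NumberTheory.BeurlingPrimes.ZetaMellin
import Mathlib.Analysis.Complex.CauchyIntegral
import Mathlib.Analysis.Analytic.Uniqueness
import Mathlib.Analysis.Complex.Convex
import HarnessLib

/-!
# A pole of `ζ_P` at `s = 1/2` excludes `N_P(x) = ax + O(x^{1/2−ε})` (BDR 2023, proof of Corollary 3.3)

Topic `Literature/NumberTheory/BeurlingPrimes`. Everything in this file is PROVED.

BDR, proof of Corollary 3.3 (case `β = 1/2`): "with the presence of a pole of `ζ_𝒫(s)` at `s = β = 1/2`, it
is clear from `ζ_𝒫(s) − as/(s−1) = s∫_1^∞ x^{−(s+1)}(N_𝒫(x) − ax) dx` that `N_𝒫(x) − ax ≪ x^{1/2−ε}` cannot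
hold for any `ε > 0`, as that would make the integral absolutely convergent and the function `ζ_𝒫` analytic
around `1/2`."

`not_intErrorLE_of_zeta_pole`: if `ζ_P(s) = s/(s−1) · s/(s−1/2) · Π_{ρ∈ℛ}(s−ρ)/s · (s/(s−δ))^M · e^{Z(s)}` on
`Re s > 1` with `Z` holomorphic on `Re s > 0`, `0 < δ < 1/2`, `1/2 ∉ ℛ` (the shape delivered by
`BrouckeDebruyneRevesz2023_thm32` with `𝒮 = {1/2}`), then `IntErrorLE a (1/2 − ε)` fails for every `ε > 0` and
every `a`. Proof: Landau's lemma (`ZetaMellin.lean`) makes `F₁(s) = (s−1)ζ_P(s) = as + s(s−1)G(s)` holomorphic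
on `Re s > 1/2 − ε'` (`ε' ≤ ε` small), while `F₂(s) = s · s/(s−1/2) · Π(s−ρ)/s · (s/(s−δ))^M e^{Z(s)}` is
holomorphic on the convex set `Re s > 1/2`; they agree on `Re s > 1`, hence on `Re s > 1/2` (identity
theorem), but `F₁(1/2 + t) → F₁(1/2)` whereas `‖F₂(1/2 + t)‖ → ∞` as `t → 0⁺`.

## References
* [BrouckeDebruyneRevesz2023] F. Broucke, G. Debruyne, Sz. Gy. Révész, *Some examples of well-behaved Beurling
  number systems*, arXiv:2309.01567, proof of Corollary 3.3.
-/

noncomputable section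

open Filter Set Complex
open scoped Topology

namespace Literature.NumberTheory.BeurlingPrimes

open Literature.Barriers.RiemannHypothesis

/-- The sequence `s_n = 1/2 + 1/(n+4)` in `(1/2, 3/4]`, tending to `1/2`. [folklore] -/
theorem tendsto_half_add_inv : Tendsto (fun n : ℕ ↦ ((1 / 2 + 1 / ((n : ℝ) + 4) : ℝ) : ℂ)) atTop (𝓝 ((1 / 2 : ℝ) : ℂ)) := by
  refine (Complex.continuous_ofReal.tendsto _).comp ?_
  have h : Tendsto (fun n : ℕ ↦ 1 / ((n : ℝ) + 4)) atTop (𝓝 0) := by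
    have := tendsto_one_div_add_atTop_nhds_zero_nat (𝕜 := ℝ)
    refine (tendsto_one_div_add_atTop_nhds_zero_nat.comp (tendsto_add_atTop_nat 3)).congr fun n ↦ ?_
    simp only [Function.comp_apply]
    push_cast
    ring_nf
  simpa using h.const_add (1 / 2 : ℝ)

/-- **A pole of `ζ_P` at `1/2` excludes `N_P(x) = ax + O(x^{1/2−ε})`** (BDR, proof of Cor. 3.3, `β = 1/2`).
[cite: BrouckeDebruyneRevesz2023, proof of Corollary 3.3] -/
theorem _root_.Literature.Barriers.RiemannHypothesis.BeurlingPrimes.not_intErrorLE_of_zeta_pole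
    {P : BeurlingPrimes} {a δ : ℝ} {R : Finset ℝ} {M : ℕ} {Z : ℂ → ℂ}
    (hδ0 : 0 < δ) (hδ : δ < 1 / 2) (hR : ∀ ρ ∈ R, ρ ≠ 1 / 2) (hZd : DifferentiableOn ℂ Z {s : ℂ | 0 < s.re})
    (hζ : ∀ s : ℂ, 1 < s.re → P.zeta s =
      s / (s - 1) * (s / (s - (1 / 2 : ℝ))) * (∏ ρ ∈ R, (s - ρ) / s) * (s / (s - δ)) ^ M * Complex.exp (Z s))
    {ε : ℝ} (hε : 0 < ε) : ¬ P.IntErrorLE a (1 / 2 - ε) := by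
  intro hI
  -- shrink `ε` so that `θ = 1/2 − ε' > δ`
  set ε' : ℝ := min ε ((1 / 2 - δ) / 2) with hε'
  have hε'0 : 0 < ε' := lt_min hε (by linarith)
  have hε'le : ε' ≤ ε := min_le_left _ _
  have hθδ : δ < 1 / 2 - ε' := by have := min_le_right ε ((1 / 2 - δ) / 2); linarith
  have hI' : P.IntErrorLE a (1 / 2 - ε') := BeurlingPrimes.IntErrorLE.of_le P hI (by linarith)
  obtain ⟨G, hGd, hGζ⟩ := P.exists_continuation_of_intErrorLE (by linarith) hI'
  -- the two functions
  set F₁ : ℂ → ℂ := fun s ↦ a * s + s * (s - 1) * G s with hF₁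
  set Rf : ℂ → ℂ := fun s ↦ ∏ ρ ∈ R, (s - ρ) / s with hRf
  set F₂ : ℂ → ℂ := fun s ↦ s * (s / (s - (1 / 2 : ℝ))) * Rf s * (s / (s - δ)) ^ M * Complex.exp (Z s) with hF₂
  set U : Set ℂ := {s : ℂ | 1 / 2 - ε' < s.re} with hU
  set D : Set ℂ := {s : ℂ | 1 / 2 < s.re} with hD
  have hUo : IsOpen U := isOpen_lt continuous_const Complex.continuous_re
  have hDo : IsOpen D := isOpen_lt continuous_const Complex.continuous_re
  have hDU : D ⊆ U := fun s hs ↦ by simp only [hD, hU, mem_setOf_eq] at hs ⊢; linarith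
  -- holomorphy
  have hF₁d : DifferentiableOn ℂ F₁ U := by
    refine DifferentiableOn.add (by fun_prop) (DifferentiableOn.mul (by fun_prop) hGd)
  have hRfd : DifferentiableOn ℂ Rf {s : ℂ | s ≠ 0} := by
    simp only [hRf]
    refine DifferentiableOn.fun_finsetProd (𝔸' := ℂ) fun ρ _ ↦ ?_
    exact DifferentiableOn.div (by fun_prop) (by fun_prop) fun s hs ↦ hs
  have hF₂d : DifferentiableOn ℂ F₂ D := by
    have h0 : ∀ s ∈ D, s ≠ 0 := fun s hs h ↦ by
      simp only [hD, mem_setOf_eq, h, zero_re] at hs; linarith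
    have h12 : ∀ s ∈ D, s - ((1 / 2 : ℝ) : ℂ) ≠ 0 := fun s hs h ↦ by
      rw [sub_eq_zero] at h; simp only [hD, mem_setOf_eq, h, ofReal_re] at hs; linarith
    have hδ' : ∀ s ∈ D, s - (δ : ℂ) ≠ 0 := fun s hs h ↦ by
      rw [sub_eq_zero] at h; simp only [hD, mem_setOf_eq, h, ofReal_re] at hs; linarith
    refine DifferentiableOn.mul (DifferentiableOn.mul (DifferentiableOn.mul (DifferentiableOn.mul
      differentiableOn_id (DifferentiableOn.div differentiableOn_id (by fun_prop) h12))
      (hRfd.mono fun s hs ↦ h0 s hs)) (DifferentiableOn.pow (DifferentiableOn.div differentiableOn_id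
      (by fun_prop) hδ') M)) ?_
    exact (hZd.mono fun s hs ↦ by simp only [hD, mem_setOf_eq] at hs; exact lt_trans one_half_pos hs).cexp
  -- agreement on `Re s > 1`
  have hagree : ∀ s : ℂ, 1 < s.re → F₁ s = F₂ s := by
    intro s hs
    have hs1 : s - 1 ≠ 0 := fun h ↦ by rw [sub_eq_zero] at h; rw [h] at hs; simp at hs
    have h1 := hGζ s hs
    rw [hζ s hs] at h1
    simp only [hF₁, hF₂, hRf]
    rw [← h1]
    field_simp
  -- identity theorem on the convex set `D`
  have hconv : Convex ℝ D := convex_halfSpace_re_gt (1 / 2)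
  have heq : EqOn F₁ F₂ D := by
    refine AnalyticOnNhd.eqOn_of_preconnected_of_eventuallyEq (hF₁d.mono hDU |>.analyticOnNhd hDo)
      (hF₂d.analyticOnNhd hDo) hconv.isPreconnected (z₀ := 2) (by norm_num [hD]) ?_
    have hopen : IsOpen {s : ℂ | 1 < s.re} := isOpen_lt continuous_const Complex.continuous_re
    filter_upwards [hopen.mem_nhds (show (2 : ℂ) ∈ {s : ℂ | 1 < s.re} by simp)] with s hs
    exact hagree s hs
  -- the sequence `s_n = 1/2 + 1/(n+4)`
  set t : ℕ → ℝ := fun n ↦ 1 / ((n : ℝ) + 4) with ht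
  have ht0 : ∀ n, 0 < t n := fun n ↦ by simp only [ht]; positivity
  have ht4 : ∀ n, t n ≤ 1 / 4 := fun n ↦ by
    simp only [ht]; rw [div_le_div_iff₀ (by positivity) (by norm_num)]; linarith [n.cast_nonneg (α := ℝ)]
  set sq : ℕ → ℂ := fun n ↦ ((1 / 2 + t n : ℝ) : ℂ) with hsq
  have hsqD : ∀ n, sq n ∈ D := fun n ↦ by
    simp only [hD, hsq, mem_setOf_eq, ofReal_re]; linarith [ht0 n]
  have hsq_tend : Tendsto sq atTop (𝓝 ((1 / 2 : ℝ) : ℂ)) := tendsto_half_add_inv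
  -- `F₁(s_n)` converges
  have hhalfU : ((1 / 2 : ℝ) : ℂ) ∈ U := by simp only [hU, mem_setOf_eq, ofReal_re]; linarith
  have hF₁lim : Tendsto (fun n ↦ F₁ (sq n)) atTop (𝓝 (F₁ ((1 / 2 : ℝ) : ℂ))) :=
    ((hF₁d.differentiableAt (hUo.mem_nhds hhalfU)).continuousAt.tendsto).comp hsq_tend
  -- `‖F₂(s_n)‖ → ∞`: `F₂(s_n) = H(s_n) / t_n` with `H` continuous at `1/2`, `H(1/2) ≠ 0`
  set H : ℂ → ℂ := fun s ↦ s * s * Rf s * (s / (s - δ)) ^ M * Complex.exp (Z s) with hH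
  have hHF₂ : ∀ n, F₂ (sq n) = H (sq n) / (t n : ℂ) := by
    intro n
    have htn : (t n : ℂ) ≠ 0 := by exact_mod_cast (ht0 n).ne'
    have e : sq n - ((1 / 2 : ℝ) : ℂ) = (t n : ℂ) := by simp only [hsq]; push_cast; ring
    simp only [hF₂, hH]
    rw [e]
    field_simp
  have hH0 : H ((1 / 2 : ℝ) : ℂ) ≠ 0 := by
    have h12 : ((1 / 2 : ℝ) : ℂ) ≠ 0 := by norm_num
    have hRf0 : Rf ((1 / 2 : ℝ) : ℂ) ≠ 0 := by
      simp only [hRf]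
      refine Finset.prod_ne_zero_iff.mpr fun ρ hρ ↦ div_ne_zero ?_ h12
      rw [sub_ne_zero]
      intro h
      exact hR ρ hρ (by exact_mod_cast h.symm)
    have hδ12 : ((1 / 2 : ℝ) : ℂ) - (δ : ℂ) ≠ 0 := by
      rw [sub_ne_zero]; intro h; have := congrArg Complex.re h; simp at this; linarith
    simp only [hH]
    exact mul_ne_zero (mul_ne_zero (mul_ne_zero (mul_ne_zero h12 h12) hRf0)
      (pow_ne_zero _ (div_ne_zero h12 hδ12))) (Complex.exp_ne_zero _)
  have hHc : ContinuousAt H ((1 / 2 : ℝ) : ℂ) := by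
    have h12 : ((1 / 2 : ℝ) : ℂ) ≠ 0 := by norm_num
    have hδ12 : ((1 / 2 : ℝ) : ℂ) - (δ : ℂ) ≠ 0 := by
      rw [sub_ne_zero]; intro h; have := congrArg Complex.re h; simp at this; linarith
    have hZc : ContinuousAt Z ((1 / 2 : ℝ) : ℂ) :=
      (hZd.differentiableAt ((isOpen_lt continuous_const Complex.continuous_re).mem_nhds
        (by simp : ((1 / 2 : ℝ) : ℂ) ∈ {s : ℂ | 0 < s.re}))).continuousAt
    have hRfc : ContinuousAt Rf ((1 / 2 : ℝ) : ℂ) :=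
      (hRfd.differentiableAt ((isOpen_ne).mem_nhds h12)).continuousAt
    simp only [hH]
    refine ContinuousAt.mul (ContinuousAt.mul (ContinuousAt.mul (continuousAt_id.mul continuousAt_id) hRfc)
      (ContinuousAt.pow (continuousAt_id.div (continuousAt_id.sub continuousAt_const) hδ12) M)) hZc.cexp
  have hHlim : Tendsto (fun n ↦ ‖H (sq n)‖) atTop (𝓝 ‖H ((1 / 2 : ℝ) : ℂ)‖) :=
    ((continuous_norm.continuousAt.comp hHc).tendsto).comp hsq_tend
  have hnorm : Tendsto (fun n ↦ ‖F₂ (sq n)‖) atTop atTop := by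
    have h1 : Tendsto (fun n ↦ ‖H (sq n)‖ * (1 / t n)) atTop atTop := by
      refine Tendsto.pos_mul_atTop (norm_pos_iff.mpr hH0) hHlim ?_
      simp only [ht, one_div, inv_inv]
      exact tendsto_natCast_atTop_atTop.atTop_add tendsto_const_nhds
    refine h1.congr fun n ↦ ?_
    rw [hHF₂ n, norm_div, Complex.norm_real, Real.norm_eq_abs, abs_of_pos (ht0 n)]
    ring
  -- contradiction: `F₁(s_n) = F₂(s_n)` is both convergent and unbounded
  have heq' : (fun n ↦ ‖F₂ (sq n)‖) = fun n ↦ ‖F₁ (sq n)‖ := funext fun n ↦ by rw [heq (hsqD n)]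
  rw [heq'] at hnorm
  exact not_tendsto_atTop_of_tendsto_nhds hF₁lim.norm hnorm

end Literature.NumberTheory.BeurlingPrimes
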